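import Summits.AnomalousDissipation.AnomalousDissipation.Theorems.MomentParityPathField
import Literature.Analysis.FluidPDE.StatisticalSolutionEnergyEq

/-!
# Crux `EnsembleRealization` (stmt-AnomalousDissipation-0215) — line `augmented-lift`,
# sub-stub M2a `stub_augLimit`, tools part (i): the limit law of the level laws

Supports stmt-AnomalousDissipation-0215 (sub-stub `stub_augLimit` of the reshaped stub
`stub_augmentedLaw`, line `augmented-lift`). Nothing here closes an item.

Pure measure theory on the compact metrizable augmented trajectory space
`X = 𝒦(R, L) × [0, b]^ℚ` (`pathSpace` × the Mathlib cube subtype): a sequence of probability laws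
`P n` on `X` has a weakly convergent subsequence `P (φ i) → Q̃` (`CompactSpace (ProbabilityMeasure X)`,
Prokhorov on a compact space); bounded continuous functionals pass to the limit
(`integral_limitLaw_le`); shift invariance of the path marginals passes to the limit
(`map_pathShiftOn_limitLaw`); the joint one-time laws at rational times are identified from
bounded continuous tests (`map_eq_map_of_forall_bcf`, uniqueness of finite Borel measures on the
Polish space `(ℤ³ → ℂ³) × ℝ`), and the coefficient marginals of the path law at EVERY real time
`t ≥ 0` follow by path continuity (`pathExt` along the dyadic approximations, dominated
convergence). Main statement: `exists_limitLaw` (= `stub_augLimitLawTools`).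
-/

noncomputable section

set_option linter.dupNamespace false

open MeasureTheory Set Filter Topology Function Metric UnitAddTorus
open scoped BigOperators ENNReal InnerProductSpace RealInnerProductSpace

namespace Summit.AnomalousDissipation.AnomalousDissipation.Theorems.EnsembleRealization

open Literature.Analysis.FunctionSpaces Literature.Analysis.FunctionSpaces.Torus
open Literature.Analysis.FluidPDE Literature.Analysis.FluidPDE.Torus
open Summit.AnomalousDissipation.AnomalousDissipation.Theorems.MomentParity

variable {μ : Measure (Torus.energySpace (Fin 3))} {R : ℝ} {L : (Fin 3 → ℤ) → ℝ} {b : ℝ}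

/-! ### Compactness of the augmented trajectory space -/

/-- The cube `[0, b]^ℚ` is compact (Tychonoff). -/
theorem compactSpace_cube (b : ℝ) : CompactSpace ↥((Set.univ : Set ℚ).pi fun _ : ℚ => Set.Icc (0 : ℝ) b) :=
  isCompact_iff_compactSpace.1 (isCompact_univ_pi fun _ => isCompact_Icc)

/-- The augmented trajectory space `𝒦 × [0, b]^ℚ` is compact. -/
theorem compactSpace_aug (R : ℝ) (L : (Fin 3 → ℤ) → ℝ) (b : ℝ) :
    CompactSpace (↥(pathSpace R L : Set (Path (Fin 3))) × ↥((Set.univ : Set ℚ).pi fun _ : ℚ => Set.Icc (0 : ℝ) b)) := by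
  haveI := compactSpace_pathSpace (d := Fin 3) R L
  haveI := compactSpace_cube b
  infer_instance

/-! ### Bounded continuous functionals along a weakly convergent sequence -/

/-- Along a weakly convergent sequence of probability measures, the integrals of a continuous
bounded function converge. -/
theorem tendsto_integral_of_tendsto {X : Type*} [MeasurableSpace X] [TopologicalSpace X]
    [OpensMeasurableSpace X] {μs : ℕ → ProbabilityMeasure X} {Qp : ProbabilityMeasure X}
    (hlim : Tendsto μs atTop (𝓝 Qp)) {g : X → ℝ} (hg : Continuous g) {B : ℝ} (hB : ∀ x, |g x| ≤ B) :
    Tendsto (fun i => ∫ x, g x ∂(μs i : Measure X)) atTop (𝓝 (∫ x, g x ∂(Qp : Measure X))) := by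
  have h := (ProbabilityMeasure.tendsto_iff_forall_integral_tendsto.1 hlim)
    (BoundedContinuousFunction.ofNormedAddCommGroup g hg B fun x => by
      rw [Real.norm_eq_abs]; exact hB x)
  simpa using h

/-- **Upper bounds pass to weak limits**: if eventually `∫ g d(μs i) ≤ C + γ` for every `γ > 0`,
then `∫ g dQ ≤ C` for the weak limit `Q` (`g` continuous and bounded). -/
theorem integral_le_of_tendsto {X : Type*} [MeasurableSpace X] [TopologicalSpace X]
    [OpensMeasurableSpace X] {μs : ℕ → ProbabilityMeasure X} {Qp : ProbabilityMeasure X}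
    (hlim : Tendsto μs atTop (𝓝 Qp)) {g : X → ℝ} (hg : Continuous g) {B : ℝ} (hB : ∀ x, |g x| ≤ B)
    {C : ℝ} (hC : ∀ γ : ℝ, 0 < γ → ∀ᶠ i in atTop, ∫ x, g x ∂(μs i : Measure X) ≤ C + γ) :
    ∫ x, g x ∂(Qp : Measure X) ≤ C := by
  refine le_of_forall_pos_le_add fun γ hγ => ?_
  exact le_of_tendsto (tendsto_integral_of_tendsto hlim hg hB) (hC γ hγ)

/-- **Identities pass to weak limits**: if `∫ g d(μs i) → I`, then `∫ g dQ = I`. -/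
theorem integral_eq_of_tendsto {X : Type*} [MeasurableSpace X] [TopologicalSpace X]
    [OpensMeasurableSpace X] {μs : ℕ → ProbabilityMeasure X} {Qp : ProbabilityMeasure X}
    (hlim : Tendsto μs atTop (𝓝 Qp)) {g : X → ℝ} (hg : Continuous g) {B : ℝ} (hB : ∀ x, |g x| ≤ B)
    {I : ℝ} (hI : Tendsto (fun i => ∫ x, g x ∂(μs i : Measure X)) atTop (𝓝 I)) :
    ∫ x, g x ∂(Qp : Measure X) = I :=
  tendsto_nhds_unique (tendsto_integral_of_tendsto hlim hg hB) hI

/-! ### Uniqueness of push-forward laws from bounded continuous tests -/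

/-- **Two push-forward laws on a metrizable space agree as soon as they integrate every bounded
continuous function alike.** -/
theorem map_eq_map_of_forall_bcf {X Y Z : Type*} [MeasurableSpace X] [MeasurableSpace Y]
    [MeasurableSpace Z] [TopologicalSpace Z] [TopologicalSpace.PseudoMetrizableSpace Z] [BorelSpace Z]
    {P : Measure X} {ρ : Measure Y} [IsFiniteMeasure P] [IsFiniteMeasure ρ] {F : X → Z} {G : Y → Z}
    (hF : Measurable F) (hG : Measurable G)
    (h : ∀ φ : Z → ℝ, Continuous φ → (∃ B : ℝ, ∀ z, |φ z| ≤ B) →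
      ∫ x, φ (F x) ∂P = ∫ y, φ (G y) ∂ρ) :
    P.map F = ρ.map G := by
  refine ext_of_forall_integral_eq_of_IsFiniteMeasure fun φ => ?_
  rw [integral_map hF.aemeasurable φ.continuous.aestronglyMeasurable,
    integral_map hG.aemeasurable φ.continuous.aestronglyMeasurable]
  exact h φ φ.continuous ⟨‖φ‖, fun z => by rw [← Real.norm_eq_abs]; exact φ.norm_coe_le_norm z⟩

/-! ### Measurability and continuity of the evaluation maps -/

/-- The joint one-time evaluation `x ↦ (x.1(q, ·), x.2 q)` on `𝒦 × [0, b]^ℚ` is continuous. -/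
theorem continuous_evalAug (q : ℚ) :
    Continuous fun x : ↥(pathSpace R L : Set (Path (Fin 3))) × ↥((Set.univ : Set ℚ).pi fun _ : ℚ => Set.Icc (0 : ℝ) b) => ((fun k : Fin 3 → ℤ =>
          x.1.1 (q, k)), x.2.1 q) := by
  refine Continuous.prodMk (continuous_pi fun k => ?_) ?_
  · exact (continuous_apply (q, k)).comp (continuous_subtype_val.comp continuous_fst)
  · exact (continuous_apply q).comp (continuous_subtype_val.comp continuous_snd)

/-- The coefficient map of the trajectory space at a real time, `ω ↦ (k ↦ ω̄(t, k))`, is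
continuous (into the product topology). -/
theorem continuous_pathCoeff (R : ℝ) (L : (Fin 3 → ℤ) → ℝ) (t : ℝ) :
    Continuous fun ω : ↥(pathSpace R L : Set (Path (Fin 3))) => fun k : Fin 3 → ℤ => pathExt ω.1 t k :=
  continuous_pi fun k => continuous_pathExt_subtype R L t k

/-- The coefficient map of the trajectory space at a real time is measurable. -/
theorem measurable_pathCoeff' (R : ℝ) (L : (Fin 3 → ℤ) → ℝ) (t : ℝ) :
    Measurable fun ω : ↥(pathSpace R L : Set (Path (Fin 3))) => fun k : Fin 3 → ℤ => pathExt ω.1 t k :=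
  measurable_pi_lambda _ fun k => (continuous_pathExt_subtype R L t k).measurable

/-- The Fourier-coefficient map of the energy space, `u ↦ (k ↦ û(k))`, is continuous. -/
theorem continuous_fieldCoeff :
    Continuous fun u : Torus.energySpace (Fin 3) => fun k : Fin 3 → ℤ =>
      mFourierCoeff (EuclideanSpace.complexify ∘ (u.1 : UnitAddTorus (Fin 3) → EuclideanSpace ℝ (Fin 3))) k :=
  continuous_pi fun k => (continuous_mFourierCoeff_complexify_coe k).comp continuous_subtype_val

/-- The Fourier-coefficient map of the energy space is measurable. -/
theorem measurable_fieldCoeff' :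
    Measurable fun u : Torus.energySpace (Fin 3) => fun k : Fin 3 → ℤ =>
      mFourierCoeff (EuclideanSpace.complexify ∘ (u.1 : UnitAddTorus (Fin 3) → EuclideanSpace ℝ (Fin 3))) k :=
  measurable_pi_lambda _ fun k =>
    ((continuous_mFourierCoeff_complexify_coe k).comp continuous_subtype_val).measurable

/-- The joint map `u ↦ (û, ‖u‖²)` of the energy space is measurable. -/
theorem measurable_fieldCoeffEnergy :
    Measurable fun u : Torus.energySpace (Fin 3) => ((fun k : Fin 3 → ℤ =>
      mFourierCoeff (EuclideanSpace.complexify ∘ (u.1 : UnitAddTorus (Fin 3) → EuclideanSpace ℝ (Fin 3))) k),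
      ‖u‖ ^ 2) :=
  measurable_fieldCoeff'.prodMk (continuous_norm.pow 2).measurable

/-! ### The limit law -/

/-- **Subsequential weak limits on the compact augmented trajectory space.** Every sequence of
probability laws on `𝒦 × [0, b]^ℚ` has a subsequence converging in law to a probability law. -/
theorem exists_tendsto_probabilityMeasure (P : ℕ → Measure (↥(pathSpace R L : Set (Path (Fin 3))) × ↥((Set.univ : Set ℚ).pi fun _ : ℚ => Set.Icc (0 :
      ℝ) b))) (hP : ∀ n, IsProbabilityMeasure (P n)) :
    ∃ (Qp : ProbabilityMeasure (↥(pathSpace R L : Set (Path (Fin 3))) × ↥((Set.univ : Set ℚ).pi fun _ : ℚ => Set.Icc (0 : ℝ) b))) (φ : ℕ → ℕ) (μs : ℕ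
          → ProbabilityMeasure (↥(pathSpace R L : Set (Path (Fin 3))) × ↥((Set.univ : Set ℚ).pi fun _ : ℚ => Set.Icc (0 : ℝ) b))), StrictMono φ ∧
      (∀ i, (μs i : Measure (↥(pathSpace R L : Set (Path (Fin 3))) × ↥((Set.univ : Set ℚ).pi fun _ : ℚ => Set.Icc (0 : ℝ) b))) = P (φ i)) ∧ Tendsto
            μs atTop (𝓝 Qp) := by
  haveI := compactSpace_aug R L b
  set ν : ℕ → ProbabilityMeasure (↥(pathSpace R L : Set (Path (Fin 3))) × ↥((Set.univ : Set ℚ).pi fun _ : ℚ => Set.Icc (0 : ℝ) b)) := fun n => ⟨P n,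
        hP n⟩ with hν
  obtain ⟨Qp, φ, hφ, hlim⟩ := CompactSpace.tendsto_subseq ν
  exact ⟨Qp, φ, ν ∘ φ, hφ, fun i => rfl, hlim⟩

/-- **Shift invariance of the path marginal passes to the limit.** -/
theorem map_pathShiftOn_limitLaw {P : ℕ → Measure (↥(pathSpace R L : Set (Path (Fin 3))) × ↥((Set.univ : Set ℚ).pi fun _ : ℚ => Set.Icc (0 : ℝ) b))}
    (hθ : ∀ n, ((P n).map Prod.fst).map (pathShiftOn R L (pathShift_mapsTo R L)) = (P n).map Prod.fst)
    {Qp : ProbabilityMeasure (↥(pathSpace R L : Set (Path (Fin 3))) × ↥((Set.univ : Set ℚ).pi fun _ : ℚ => Set.Icc (0 : ℝ) b))} {φ : ℕ → ℕ} {μs : ℕ →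
          ProbabilityMeasure (↥(pathSpace R L : Set (Path (Fin 3))) × ↥((Set.univ : Set ℚ).pi fun _ : ℚ => Set.Icc (0 : ℝ) b))}
    (hμs : ∀ i, (μs i : Measure (↥(pathSpace R L : Set (Path (Fin 3))) × ↥((Set.univ : Set ℚ).pi fun _ : ℚ => Set.Icc (0 : ℝ) b))) = P (φ i)) (hlim :
          Tendsto μs atTop (𝓝 Qp)) :
    ((Qp : Measure (↥(pathSpace R L : Set (Path (Fin 3))) × ↥((Set.univ : Set ℚ).pi fun _ : ℚ => Set.Icc (0 : ℝ) b))).map Prod.fst).map (pathShiftOn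
          R L (pathShift_mapsTo R L)) =
      (Qp : Measure (↥(pathSpace R L : Set (Path (Fin 3))) × ↥((Set.univ : Set ℚ).pi fun _ : ℚ => Set.Icc (0 : ℝ) b))).map Prod.fst := by
  have hc : Continuous (pathShiftOn (d := Fin 3) R L (pathShift_mapsTo R L)) := continuous_pathShiftOn R L
  have hfst : Continuous (Prod.fst : ↥(pathSpace R L : Set (Path (Fin 3))) × ↥((Set.univ : Set ℚ).pi fun _ : ℚ => Set.Icc (0 : ℝ) b) → ↥(pathSpace R
        L : Set (Path (Fin 3)))) := continuous_fst
  have h1 := ProbabilityMeasure.tendsto_map_of_tendsto_of_continuous _ _ hlim hfst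
  have h2 := ProbabilityMeasure.tendsto_map_of_tendsto_of_continuous _ _ h1 hc
  have h3 : (fun i => ((μs i).map hfst.measurable.aemeasurable).map hc.measurable.aemeasurable) =
      fun i => (μs i).map hfst.measurable.aemeasurable := by
    funext i
    apply ProbabilityMeasure.toMeasure_injective
    simp only [ProbabilityMeasure.toMeasure_map, hμs i]
    exact hθ (φ i)
  rw [h3] at h2
  have h4 := congrArg ProbabilityMeasure.toMeasure (tendsto_nhds_unique h2 h1)
  simp only [ProbabilityMeasure.toMeasure_map] at h4
  exact h4

/-- **The joint one-time laws at rational times pass to the limit**: if the joint laws of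
`(x.1(q, ·), x.2 q)` under `P n` converge (against bounded continuous tests) to the law of
`(û, ‖u‖²)` under `μ`, then under the limit law they ARE that law. -/
theorem map_evalAug_limitLaw [IsFiniteMeasure μ] {P : ℕ → Measure (↥(pathSpace R L : Set (Path (Fin 3))) × ↥((Set.univ : Set ℚ).pi fun _ : ℚ =>
      Set.Icc (0 : ℝ) b))}
    (hmargP : ∀ q : ℚ, 0 ≤ q → ∀ φ : ((Fin 3 → ℤ) → EuclideanSpace ℂ (Fin 3)) × ℝ → ℝ, Continuous φ → (∃ B : ℝ, ∀ z, |φ z| ≤ B) →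
      Tendsto (fun n => ∫ x, φ ((fun k : Fin 3 → ℤ => x.1.1 (q, k)), x.2.1 q) ∂(P n)) atTop
        (𝓝 (∫ u, φ ((fun k : Fin 3 → ℤ =>
          mFourierCoeff (EuclideanSpace.complexify ∘ (u.1 : UnitAddTorus (Fin 3) → EuclideanSpace ℝ (Fin 3))) k),
          ‖u‖ ^ 2) ∂μ)))
    {Qp : ProbabilityMeasure (↥(pathSpace R L : Set (Path (Fin 3))) × ↥((Set.univ : Set ℚ).pi fun _ : ℚ => Set.Icc (0 : ℝ) b))} {φ : ℕ → ℕ} (hφ :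
          StrictMono φ) {μs : ℕ → ProbabilityMeasure (↥(pathSpace R L : Set (Path (Fin 3))) × ↥((Set.univ : Set ℚ).pi fun _ : ℚ => Set.Icc (0 : ℝ) b))}
    (hμs : ∀ i, (μs i : Measure (↥(pathSpace R L : Set (Path (Fin 3))) × ↥((Set.univ : Set ℚ).pi fun _ : ℚ => Set.Icc (0 : ℝ) b))) = P (φ i)) (hlim :
          Tendsto μs atTop (𝓝 Qp))
    {q : ℚ} (hq : 0 ≤ q) :
    (Qp : Measure (↥(pathSpace R L : Set (Path (Fin 3))) × ↥((Set.univ : Set ℚ).pi fun _ : ℚ => Set.Icc (0 : ℝ) b))).map (fun x => ((fun k : Fin 3 →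
          ℤ => x.1.1 (q, k)), x.2.1 q)) =
      μ.map (fun u : Torus.energySpace (Fin 3) => ((fun k : Fin 3 → ℤ =>
        mFourierCoeff (EuclideanSpace.complexify ∘ (u.1 : UnitAddTorus (Fin 3) → EuclideanSpace ℝ (Fin 3))) k),
        ‖u‖ ^ 2)) := by
  refine map_eq_map_of_forall_bcf (continuous_evalAug q).measurable measurable_fieldCoeffEnergy
    fun ψ hψ hB => ?_
  obtain ⟨B, hB⟩ := hB
  refine integral_eq_of_tendsto hlim (hψ.comp (continuous_evalAug q)) (fun x => hB _) ?_
  have h := (hmargP q hq ψ hψ ⟨B, hB⟩).comp hφ.tendsto_atTop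
  refine h.congr fun i => ?_
  simp only [Function.comp_apply, hμs i]

/-- **The coefficient marginals of the limit path law at rational times.** -/
theorem map_pathCoeff_limitLaw_rat [IsFiniteMeasure μ] (Qt : Measure (↥(pathSpace R L : Set (Path (Fin 3))) × ↥((Set.univ : Set ℚ).pi fun _ : ℚ =>
      Set.Icc (0 : ℝ) b)))
    (hjoint : ∀ q : ℚ, 0 ≤ q →
      Qt.map (fun x => ((fun k : Fin 3 → ℤ => x.1.1 (q, k)), x.2.1 q)) =
        μ.map (fun u : Torus.energySpace (Fin 3) => ((fun k : Fin 3 → ℤ =>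
          mFourierCoeff (EuclideanSpace.complexify ∘ (u.1 : UnitAddTorus (Fin 3) → EuclideanSpace ℝ (Fin 3))) k),
          ‖u‖ ^ 2)))
    {q : ℚ} (hq : 0 ≤ q) :
    (Qt.map Prod.fst).map (fun ω : ↥(pathSpace R L : Set (Path (Fin 3))) => fun k : Fin 3 → ℤ => pathExt ω.1 q k) =
      μ.map (fun u : Torus.energySpace (Fin 3) => fun k : Fin 3 → ℤ =>
        mFourierCoeff (EuclideanSpace.complexify ∘ (u.1 : UnitAddTorus (Fin 3) → EuclideanSpace ℝ (Fin 3))) k) := by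
  have hmF : Measurable (fun x : ↥(pathSpace R L : Set (Path (Fin 3))) × ↥((Set.univ : Set ℚ).pi fun _ : ℚ => Set.Icc (0 : ℝ) b) => ((fun k : Fin 3 →
        ℤ => x.1.1 (q, k)), x.2.1 q)) :=
    (continuous_evalAug q).measurable
  rw [Measure.map_map (measurable_pathCoeff' R L q) measurable_fst]
  have h1 : ((fun ω : ↥(pathSpace R L : Set (Path (Fin 3))) => fun k : Fin 3 → ℤ => pathExt ω.1 q k) ∘ Prod.fst : ↥(pathSpace R L : Set (Path (Fin
        3))) × ↥((Set.univ : Set ℚ).pi fun _ : ℚ => Set.Icc (0 : ℝ) b) → _) =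
      Prod.fst ∘ fun x : ↥(pathSpace R L : Set (Path (Fin 3))) × ↥((Set.univ : Set ℚ).pi fun _ : ℚ => Set.Icc (0 : ℝ) b) => ((fun k : Fin 3 → ℤ =>
            x.1.1 (q, k)), x.2.1 q) := by
    funext x
    simp only [Function.comp_apply]
    funext k
    exact pathExt_ratCast x.1.2 hq k
  rw [h1, ← Measure.map_map measurable_fst hmF, hjoint q hq, Measure.map_map measurable_fst
    measurable_fieldCoeffEnergy]
  rfl

/-- **The coefficient marginals of the limit path law at every real time `t ≥ 0`** (path
continuity: `ω̄(⌊t2ⁿ⌋/2ⁿ) → ω̄(t)` coordinatewise, dominated convergence of bounded continuous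
tests, and uniqueness). -/
theorem map_pathCoeff_limitLaw [IsFiniteMeasure μ] (Q : Measure ↥(pathSpace R L : Set (Path (Fin 3)))) [IsFiniteMeasure Q]
    (hrat : ∀ q : ℚ, 0 ≤ q → Q.map (fun ω : ↥(pathSpace R L : Set (Path (Fin 3))) => fun k : Fin 3 → ℤ => pathExt ω.1 q k) =
      μ.map (fun u : Torus.energySpace (Fin 3) => fun k : Fin 3 → ℤ =>
        mFourierCoeff (EuclideanSpace.complexify ∘ (u.1 : UnitAddTorus (Fin 3) → EuclideanSpace ℝ (Fin 3))) k))
    (t : ℝ) :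
    Q.map (fun ω : ↥(pathSpace R L : Set (Path (Fin 3))) => fun k : Fin 3 → ℤ => pathExt ω.1 t k) =
      μ.map (fun u : Torus.energySpace (Fin 3) => fun k : Fin 3 → ℤ =>
        mFourierCoeff (EuclideanSpace.complexify ∘ (u.1 : UnitAddTorus (Fin 3) → EuclideanSpace ℝ (Fin 3))) k) := by
  refine map_eq_map_of_forall_bcf (measurable_pathCoeff' R L t) measurable_fieldCoeff' fun ψ hψ hB => ?_
  obtain ⟨B, hB⟩ := hB
  -- the identity at the dyadic times
  have hn : ∀ n : ℕ, ∫ ω, ψ (fun k : Fin 3 → ℤ => pathExt ω.1 (dyadicFloor t n) k) ∂Q =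
      ∫ u, ψ (fun k : Fin 3 → ℤ => mFourierCoeff (EuclideanSpace.complexify ∘
        (u.1 : UnitAddTorus (Fin 3) → EuclideanSpace ℝ (Fin 3))) k) ∂μ := by
    intro n
    rw [← integral_map (measurable_pathCoeff' R L _).aemeasurable hψ.aestronglyMeasurable,
      hrat _ (dyadicFloor_nonneg t n), integral_map measurable_fieldCoeff'.aemeasurable hψ.aestronglyMeasurable]
  -- dominated convergence along the dyadic times
  have hlim : Tendsto (fun n : ℕ => ∫ ω, ψ (fun k : Fin 3 → ℤ => pathExt ω.1 (dyadicFloor t n) k) ∂Q) atTop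
      (𝓝 (∫ ω, ψ (fun k : Fin 3 → ℤ => pathExt ω.1 t k) ∂Q)) := by
    refine tendsto_integral_of_dominated_convergence (fun _ => B) (fun n => ?_) (integrable_const B) ?_ ?_
    · exact (hψ.comp (continuous_pathCoeff R L _)).aestronglyMeasurable
    · exact fun n => ae_of_all _ fun ω => by rw [Real.norm_eq_abs]; exact hB _
    · refine ae_of_all _ fun ω => (hψ.tendsto _).comp (tendsto_pi_nhds.2 fun k => ?_)
      have h := tendsto_dyadic_apply ω.2 t k
      refine h.congr fun n => ?_
      rw [pathExt_ratCast ω.2 (dyadicFloor_nonneg t n)]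
  simp only [hn, tendsto_const_nhds_iff] at hlim
  exact hlim.symm

/-- **Tools stub (to be registered as `stub_augLimitLawTools`): the limit law of the level laws.**
Probability laws `P n` on the compact metrizable augmented trajectory space `𝒦(R, L) × [0, b]^ℚ`
with shift-invariant path marginals, whose joint one-time laws at rational times `q ≥ 0` converge
to the law of `(û, ‖u‖²)` under a finite measure `μ` on `H`, have a subsequential weak limit `Q̃`
(bounded continuous functionals pass to the limit with their eventual upper bounds) whose path
marginal `Q̃.map Prod.fst` is shift invariant, whose joint one-time laws at rational times are the
law of `(û, ‖u‖²)`, and whose coefficient marginals at EVERY real time `t ≥ 0` are the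
coefficient law of `μ`. -/
theorem stub_augLimitLawTools [IsFiniteMeasure μ] {R : ℝ} {L : (Fin 3 → ℤ) → ℝ} {b : ℝ}
    (P : ℕ → Measure (↥(pathSpace R L : Set (Path (Fin 3))) × ↥((Set.univ : Set ℚ).pi fun _ : ℚ => Set.Icc (0 : ℝ) b))) (hP : ∀ n, IsProbabilityMeasure (P n))
    (hθ : ∀ n, ((P n).map Prod.fst).map (pathShiftOn R L (pathShift_mapsTo R L)) = (P n).map Prod.fst)
    (hmargP : ∀ q : ℚ, 0 ≤ q → ∀ φ : ((Fin 3 → ℤ) → EuclideanSpace ℂ (Fin 3)) × ℝ → ℝ, Continuous φ → (∃ B : ℝ, ∀ z, |φ z| ≤ B) →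
      Tendsto (fun n => ∫ x, φ ((fun k : Fin 3 → ℤ => x.1.1 (q, k)), x.2.1 q) ∂(P n)) atTop
        (𝓝 (∫ u, φ ((fun k : Fin 3 → ℤ =>
          mFourierCoeff (EuclideanSpace.complexify ∘ (u.1 : UnitAddTorus (Fin 3) → EuclideanSpace ℝ (Fin 3))) k),
          ‖u‖ ^ 2) ∂μ))) :
    ∃ Qt : Measure (↥(pathSpace R L : Set (Path (Fin 3))) × ↥((Set.univ : Set ℚ).pi fun _ : ℚ => Set.Icc (0 : ℝ) b)), IsProbabilityMeasure Qt ∧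
      (∀ g : ↥(pathSpace R L : Set (Path (Fin 3))) × ↥((Set.univ : Set ℚ).pi fun _ : ℚ => Set.Icc (0 : ℝ) b) → ℝ, Continuous g → ∀ B : ℝ, (∀ x, |g x|
            ≤ B) → ∀ C : ℝ,
        (∀ γ : ℝ, 0 < γ → ∀ᶠ n in atTop, ∫ x, g x ∂(P n) ≤ C + γ) → ∫ x, g x ∂Qt ≤ C) ∧
      (Qt.map Prod.fst).map (pathShiftOn R L (pathShift_mapsTo R L)) = Qt.map Prod.fst ∧
      (∀ q : ℚ, 0 ≤ q → Qt.map (fun x => ((fun k : Fin 3 → ℤ => x.1.1 (q, k)), x.2.1 q)) =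
        μ.map (fun u : Torus.energySpace (Fin 3) => ((fun k : Fin 3 → ℤ =>
          mFourierCoeff (EuclideanSpace.complexify ∘ (u.1 : UnitAddTorus (Fin 3) → EuclideanSpace ℝ (Fin 3))) k),
          ‖u‖ ^ 2))) ∧
      (∀ t : ℝ, 0 ≤ t → (Qt.map Prod.fst).map (fun ω : ↥(pathSpace R L : Set (Path (Fin 3))) => fun k : Fin 3 → ℤ => pathExt ω.1 t k) =
        μ.map (fun u : Torus.energySpace (Fin 3) => fun k : Fin 3 → ℤ =>
          mFourierCoeff (EuclideanSpace.complexify ∘ (u.1 : UnitAddTorus (Fin 3) → EuclideanSpace ℝ (Fin 3))) k)) := by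
  obtain ⟨Qp, φ, μs, hφ, hμs, hlim⟩ := exists_tendsto_probabilityMeasure P hP
  have hjoint : ∀ q : ℚ, 0 ≤ q → (Qp : Measure (↥(pathSpace R L : Set (Path (Fin 3))) × ↥((Set.univ : Set ℚ).pi fun _ : ℚ => Set.Icc (0 : ℝ) b))).map
      (fun x => ((fun k : Fin 3 → ℤ => x.1.1 (q, k)), x.2.1 q)) =
      μ.map (fun u : Torus.energySpace (Fin 3) => ((fun k : Fin 3 → ℤ =>
        mFourierCoeff (EuclideanSpace.complexify ∘ (u.1 : UnitAddTorus (Fin 3) → EuclideanSpace ℝ (Fin 3))) k),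
        ‖u‖ ^ 2)) := fun q hq => map_evalAug_limitLaw hmargP hφ hμs hlim hq
  haveI : IsFiniteMeasure ((Qp : Measure (↥(pathSpace R L : Set (Path (Fin 3))) ×
    ↥((Set.univ : Set ℚ).pi fun _ : ℚ => Set.Icc (0 : ℝ) b))).map Prod.fst) := inferInstance
  refine ⟨Qp, inferInstance, fun g hg B hB C hC => ?_, map_pathShiftOn_limitLaw hθ hμs hlim, hjoint,
    fun t _ => map_pathCoeff_limitLaw _ (fun q hq => map_pathCoeff_limitLaw_rat _ hjoint hq) t⟩
  refine integral_le_of_tendsto hlim hg hB fun γ hγ => ?_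
  have h := (hC γ hγ).filter_mono hφ.tendsto_atTop
  rw [eventually_map] at h
  filter_upwards [h] with i hi
  simpa only [hμs i] using hi

end Summit.AnomalousDissipation.AnomalousDissipation.Theorems.EnsembleRealization
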